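import Summits.CriticalPhenomena.CardyFormulaZ2.Theorems.CardyIKTransportIKLinearTransportPinnedDefs
import Mathlib.Probability.Kernel.Disintegration.CondCDF
import Mathlib.MeasureTheory.Constructions.Polish.EmbeddingReal

/-!
# Stub `stub_PinnedSampler` (line `pinned-diagram-exchange`, crux stmt-CriticalPhenomena-5076) —
# part T: the abstract FIBREWISE RESAMPLING (transfer) lemma

Registered sub-goal `ps_exists_fibrewise_resampler` (a `--supports stmt-CriticalPhenomena-5076` helper toward
clauses 1–3 and 5 of `PinnedSampler`): on a standard Borel space `X`, given two probability measures
`P, P'` with the SAME push-forward under a measurable `π : X → Y` (`Y` with measurable diagonal) and an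
independent randomisation `(R, β, U)` carrying a uniform variable `U` (`β {U ≤ c} = c` on `[0,1]`), there
is a jointly measurable `G : X → R → X` preserving `π` SURELY (`π (G x u) = π x` for all `x, u`) and
transporting `P ⊗ β` to `P'`. Proof: embed `X` into `ℝ` (`embeddingReal`), disintegrate the law of
`(π, e)` under `P'` through Mathlib's conditional cdf `condCDF`, sample each fibre law by the conditional
QUANTILE transform at the uniform level `U u`, identify the joint law of `(π x, sample)` with that of
`(π, e)` under `P'` (cdf slices + `Measure.ext_prod`), pull back along a measurable left inverse of `e`,
and repair the null set where the fibre is missed by falling back to the identity.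
This is the measure-theoretic half of "conditional resampling given (eraseMid, stripDiagram)"; the
line-specific instantiation (`Obs`, `νmix`, `StripDiagramExchange`) is part M (`…StubPinnedSampler.lean`).
-/

noncomputable section

namespace Summit.CriticalPhenomena.CardyFormulaZ2.Theorems.IKLinearTransport.PinnedDiagramExchange

open scoped Classical MeasureTheory ENNReal ProbabilityTheory Topology NNReal
open Set MeasureTheory ProbabilityTheory Filter
open Literature.Probability.Percolation Literature.Probability.LatticeModels

section Transfer

variable {Y : Type*} [MeasurableSpace Y]

omit [MeasurableSpace Y] in
/-- QUANTILE TRANSFORM of a family of cdfs: for every level `t ∈ (0,1)` a number `Q y t` with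
`Q y t ≤ r ↔ t ≤ F y r` (the generalised inverse; right-continuity puts the infimum inside). [folklore] -/
theorem ps_exists_quantile (F : Y → StieltjesFunction ℝ)
    (h0 : ∀ y, Tendsto (F y) atBot (𝓝 0)) (h1 : ∀ y, Tendsto (F y) atTop (𝓝 1)) :
    ∃ Q : Y → ℝ → ℝ, ∀ y, ∀ t ∈ Ioo (0 : ℝ) 1, ∀ r : ℝ, Q y t ≤ r ↔ t ≤ F y r := by
  refine ⟨fun y t => sInf {r : ℝ | t ≤ F y r}, fun y t ht r => ?_⟩
  set A : Set ℝ := {r : ℝ | t ≤ F y r} with hA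
  have hne : A.Nonempty := by
    obtain ⟨r, hr⟩ := ((h1 y).eventually (eventually_gt_nhds ht.2)).exists
    exact ⟨r, hr.le⟩
  have hbdd : BddBelow A := by
    obtain ⟨r₀, hr₀⟩ := Filter.eventually_atBot.1 ((h0 y).eventually (eventually_lt_nhds ht.1))
    refine ⟨r₀, fun r hr => ?_⟩
    by_contra hlt
    exact absurd (hr₀ r (not_le.1 hlt).le) (not_lt.2 hr)
  have hup : ∀ r r', r ∈ A → r ≤ r' → r' ∈ A := fun r r' hr hrr' => le_trans hr ((F y).mono hrr')
  have hmem : sInf A ∈ A := by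
    have hgt : ∀ r, sInf A < r → r ∈ A := fun r hr => by
      obtain ⟨a, ha, har⟩ := exists_lt_of_csInf_lt hne hr
      exact hup a r ha har.le
    have htend : Tendsto (F y) (𝓝[>] sInf A) (𝓝 (F y (sInf A))) :=
      ((F y).right_continuous (sInf A)).tendsto.mono_left
        (nhdsWithin_mono _ Ioi_subset_Ici_self)
    exact ge_of_tendsto htend (eventually_nhdsWithin_of_forall fun r hr => hgt r hr)
  constructor
  · intro h; exact hup _ _ hmem h
  · intro h; exact csInf_le hbdd h

/-- The quantile transform, guarded off `(0,1)`, is jointly measurable in (parameter, level) as soon as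
the cdfs are measurable in the parameter. [folklore] -/
theorem ps_measurable_guardedQuantile {F : Y → StieltjesFunction ℝ} {Q : Y → ℝ → ℝ}
    (hF : ∀ r, Measurable fun y => F y r)
    (hQ : ∀ y, ∀ t ∈ Ioo (0 : ℝ) 1, ∀ r : ℝ, Q y t ≤ r ↔ t ≤ F y r) :
    Measurable fun p : Y × ℝ => if p.2 ∈ Ioo (0 : ℝ) 1 then Q p.1 p.2 else 0 := by
  refine measurable_of_Iic fun r => ?_
  have hset : (fun p : Y × ℝ => if p.2 ∈ Ioo (0 : ℝ) 1 then Q p.1 p.2 else 0) ⁻¹' Iic r =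
      ({p : Y × ℝ | p.2 ∈ Ioo (0 : ℝ) 1} ∩ {p | p.2 ≤ F p.1 r}) ∪
        ({p : Y × ℝ | p.2 ∈ Ioo (0 : ℝ) 1}ᶜ ∩ {p | (0 : ℝ) ≤ r}) := by
    ext p
    simp only [mem_preimage, mem_Iic, mem_union, mem_inter_iff, mem_setOf_eq, mem_compl_iff]
    by_cases hp : p.2 ∈ Ioo (0 : ℝ) 1
    · rw [if_pos hp, hQ p.1 p.2 hp r]; tauto
    · rw [if_neg hp]; tauto
  rw [hset]
  have h2 : Measurable fun p : Y × ℝ => p.2 := measurable_snd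
  have hI : MeasurableSet {p : Y × ℝ | p.2 ∈ Ioo (0 : ℝ) 1} := measurableSet_Ioo.preimage h2
  refine (hI.inter ?_).union (hI.compl.inter ?_)
  · exact measurableSet_le h2 ((hF r).comp measurable_fst)
  · exact measurableSet_le measurable_const measurable_const

/-- A uniform level is a.s. strictly inside `(0,1)`. [folklore] -/
theorem ps_ae_mem_Ioo_of_uniform {R : Type*} [MeasurableSpace R] {β : Measure R} [IsProbabilityMeasure β]
    {U : R → ℝ} (hU : Measurable U)
    (hunif : ∀ c ∈ Icc (0 : ℝ) 1, β {u | U u ≤ c} = ENNReal.ofReal c) :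
    ∀ᵐ u ∂β, U u ∈ Ioo (0 : ℝ) 1 := by
  have h0 : β {u | U u ≤ 0} = 0 := by
    rw [hunif 0 ⟨le_rfl, zero_le_one⟩, ENNReal.ofReal_zero]
  have h1 : β {u | 1 ≤ U u} = 0 := by
    refine le_antisymm (ENNReal.le_of_forall_pos_le_add fun ε hε _ => ?_) zero_le
    rw [zero_add]
    set ε' : ℝ := min (ε : ℝ) 1 with hε'
    have hε'0 : 0 < ε' := lt_min (by exact_mod_cast hε) one_pos
    have hε'1 : ε' ≤ 1 := min_le_right _ _
    have hmeas : MeasurableSet {u | U u ≤ 1 - ε'} := measurableSet_le hU measurable_const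
    have hsub : {u | 1 ≤ U u} ⊆ {u | U u ≤ 1 - ε'}ᶜ := fun u hu h => by
      simp only [mem_setOf_eq] at hu h
      linarith
    calc β {u | 1 ≤ U u} ≤ β {u | U u ≤ 1 - ε'}ᶜ := measure_mono hsub
      _ = 1 - β {u | U u ≤ 1 - ε'} := prob_compl_eq_one_sub hmeas
      _ = ENNReal.ofReal ε' := by
        rw [hunif (1 - ε') ⟨by linarith, by linarith⟩, ← ENNReal.ofReal_one,
          ← ENNReal.ofReal_sub _ (by linarith)]
        congr 1; ring
      _ ≤ (ε : ℝ≥0∞) := by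
        rw [← ENNReal.ofReal_coe_nnreal]
        exact ENNReal.ofReal_le_ofReal (min_le_left _ _)
  filter_upwards [measure_eq_zero_iff_ae_notMem.1 h0, measure_eq_zero_iff_ae_notMem.1 h1] with u hu0 hu1
  simp only [not_le] at hu0 hu1
  exact ⟨hu0, hu1⟩

/-- Slices `t ↦ μ (s ×ˢ t)` of a measure on a product, as the second marginal of a restriction. [folklore] -/
theorem ps_snd_restrict_prod_univ_apply {Z : Type*} [MeasurableSpace Z] (μ : Measure (Y × Z))
    (s : Set Y) {t : Set Z} (ht : MeasurableSet t) :
    (μ.restrict (s ×ˢ univ)).snd t = μ (s ×ˢ t) := by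
  rw [Measure.snd_apply ht, Measure.restrict_apply (measurable_snd ht)]
  congr 1
  ext p
  simp only [mem_inter_iff, mem_preimage, mem_prod, mem_univ, and_true]
  tauto

/-- THE FIBREWISE RESAMPLING (TRANSFER) LEMMA, generic form. On a standard Borel space `X`, let `P, P'`
be probability measures with the same push-forward under a measurable `π : X → Y` (`Y` with measurable
diagonal), and let `(R, β)` carry a measurable `U` uniform on `[0,1]`. Then some jointly measurable
`G : X → R → X` preserves `π` surely and pushes `P ⊗ β` forward to `P'` (disintegration of `P'` along
`π` + conditional quantile transform + identity fallback on a null set). [folklore] -/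
theorem ps_transfer_of_uniform {X R : Type*} [MeasurableSpace X] [StandardBorelSpace X]
    [Nonempty X] [MeasurableEq Y] [MeasurableSpace R]
    {π : X → Y} (hπ : Measurable π) {P P' : Measure X} [IsProbabilityMeasure P]
    [IsProbabilityMeasure P'] (hlaw : P.map π = P'.map π) {β : Measure R} [IsProbabilityMeasure β]
    {U : R → ℝ} (hU : Measurable U)
    (hunif : ∀ c ∈ Icc (0 : ℝ) 1, β {u | U u ≤ c} = ENNReal.ofReal c) :
    ∃ G : X → R → X, Measurable (Function.uncurry G) ∧ (∀ x u, π (G x u) = π x) ∧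
      (P.prod β).map (Function.uncurry G) = P' := by
  have hU01 : ∀ᵐ u ∂β, U u ∈ Ioo (0 : ℝ) 1 := ps_ae_mem_Ioo_of_uniform hU hunif
  -- the embedding into `ℝ`, the joint law `ρ` of `(π, e)` under `P'`, its conditional cdf and quantile
  have he : MeasurableEmbedding (embeddingReal X) := measurableEmbedding_embeddingReal X
  have hπe : Measurable fun x => (π x, embeddingReal X x) := hπ.prodMk he.measurable
  obtain ⟨ρ, hρ⟩ : ∃ ρ : Measure (Y × ℝ), ρ = P'.map (fun x => (π x, embeddingReal X x)) := ⟨_, rfl⟩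
  haveI : IsProbabilityMeasure ρ := hρ ▸ Measure.isProbabilityMeasure_map hπe.aemeasurable
  have hfst : ρ.fst = P.map π := by rw [hρ, Measure.fst_map_prodMk he.measurable, hlaw]
  obtain ⟨Q, hQ⟩ := ps_exists_quantile (condCDF ρ) (tendsto_condCDF_atBot ρ) (tendsto_condCDF_atTop ρ)
  obtain ⟨Z, hZ⟩ : ∃ Z : Y × ℝ → ℝ, Z = fun p => if p.2 ∈ Ioo (0 : ℝ) 1 then Q p.1 p.2 else 0 :=
    ⟨_, rfl⟩
  have hZm : Measurable Z := hZ ▸ ps_measurable_guardedQuantile (measurable_condCDF ρ) hQ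
  have hZle : ∀ y t, t ∈ Ioo (0 : ℝ) 1 → ∀ r, Z (y, t) ≤ r ↔ t ≤ condCDF ρ y r := by
    intro y t ht r
    rw [hZ]
    dsimp only
    rw [if_pos ht]
    exact hQ y t ht r
  -- the law of `Φ = (π x, Z (π x, U u))` under `P ⊗ β` is `ρ`
  obtain ⟨Φ, hΦ⟩ : ∃ Φ : X × R → Y × ℝ, Φ = fun p => (π p.1, Z (π p.1, U p.2)) := ⟨_, rfl⟩
  have hΦm : Measurable Φ :=
    hΦ ▸ (hπ.comp measurable_fst).prodMk (hZm.comp ((hπ.comp measurable_fst).prodMk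
      (hU.comp measurable_snd)))
  have key : ∀ {s : Set Y}, MeasurableSet s → ∀ a : ℝ,
      (P.prod β).map Φ (s ×ˢ Iic a) = ρ (s ×ˢ Iic a) := by
    intro s hs a
    rw [Measure.map_apply hΦm (hs.prod measurableSet_Iic),
      Measure.prod_apply (hΦm (hs.prod measurableSet_Iic))]
    have hsec : ∀ x, β (Prod.mk x ⁻¹' (Φ ⁻¹' (s ×ˢ Iic a))) =
        s.indicator (fun y => ENNReal.ofReal (condCDF ρ y a)) (π x) := by
      intro x
      by_cases hx : π x ∈ s
      · rw [indicator_of_mem hx]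
        have hseteq : (Prod.mk x ⁻¹' (Φ ⁻¹' (s ×ˢ Iic a)) : Set R) =ᵐ[β]
            ({u | U u ≤ condCDF ρ (π x) a} : Set R) := by
          filter_upwards [hU01] with u hu
          refine propext ?_
          change Φ (x, u) ∈ s ×ˢ Iic a ↔ U u ≤ condCDF ρ (π x) a
          rw [hΦ]
          simp only [mem_prod, mem_Iic, hx, true_and]
          exact hZle (π x) (U u) hu a
        rw [measure_congr hseteq, hunif _ ⟨condCDF_nonneg ρ _ _, condCDF_le_one ρ _ _⟩]
      · rw [indicator_of_notMem hx]
        have hempty : (Prod.mk x ⁻¹' (Φ ⁻¹' (s ×ˢ Iic a)) : Set R) = ∅ := by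
          ext u
          simp only [mem_preimage, hΦ, mem_prod, mem_Iic, mem_empty_iff_false, iff_false, not_and]
          exact fun h => absurd h hx
        rw [hempty, measure_empty]
    simp_rw [hsec]
    have hg : Measurable fun y => ENNReal.ofReal (condCDF ρ y a) :=
      (measurable_condCDF ρ a).ennreal_ofReal
    rw [← lintegral_map (hg.indicator hs) hπ, lintegral_indicator hs, ← hfst,
      setLIntegral_condCDF ρ a hs]
  have hlawΦ : (P.prod β).map Φ = ρ := by
    refine Measure.ext_prod fun {s} {t} hs ht => ?_
    have h12 : (((P.prod β).map Φ).restrict (s ×ˢ univ)).snd = (ρ.restrict (s ×ˢ univ)).snd :=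
      Measure.ext_of_Iic _ _ fun a => by
        rw [ps_snd_restrict_prod_univ_apply _ s measurableSet_Iic,
          ps_snd_restrict_prod_univ_apply _ s measurableSet_Iic, key hs a]
    have := congrArg (fun μ : Measure ℝ => μ t) h12
    simpa only [ps_snd_restrict_prod_univ_apply _ s ht] using this
  -- pull back along a measurable left inverse of the embedding
  obtain ⟨einv, heinv, hinv⟩ := he.exists_measurable_extend measurable_id fun _ => ‹Nonempty X›
  have hinv' : ∀ x, einv (embeddingReal X x) = x := fun x => congrFun hinv x
  obtain ⟨G₀, hG₀⟩ : ∃ G₀ : X → R → X, G₀ = fun x u => einv (Z (π x, U u)) := ⟨_, rfl⟩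
  have hpair : (fun p : X × R => (π p.1, G₀ p.1 p.2)) = Prod.map id einv ∘ Φ := by
    funext p; rw [hG₀, hΦ]; rfl
  have hpairm : Measurable fun p : X × R => (π p.1, G₀ p.1 p.2) := by
    rw [hpair]; exact (measurable_id.prodMap heinv).comp hΦm
  have hG₀m : Measurable (Function.uncurry G₀) := by
    have : Function.uncurry G₀ = Prod.snd ∘ fun p : X × R => (π p.1, G₀ p.1 p.2) := by
      funext p; rfl
    rw [this]; exact measurable_snd.comp hpairm
  have hlaw2 : (P.prod β).map (fun p : X × R => (π p.1, G₀ p.1 p.2)) = P'.map (fun x => (π x, x)) := by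
    have h2 : (fun x => (π x, x)) = Prod.map id einv ∘ (fun x => (π x, embeddingReal X x)) := by
      funext x; simp [hinv']
    rw [hpair, ← Measure.map_map (measurable_id.prodMap heinv) hΦm, hlawΦ, hρ,
      Measure.map_map (measurable_id.prodMap heinv) hπe, h2]
  have hpm : Measurable fun x : X => (π x, x) := hπ.prodMk measurable_id
  have hpush : (P.prod β).map (Function.uncurry G₀) = P' := by
    have h1 : Function.uncurry G₀ = Prod.snd ∘ fun p : X × R => (π p.1, G₀ p.1 p.2) := by
      funext p; rfl
    have h2 : (Prod.snd ∘ fun x : X => (π x, x)) = id := by funext x; rfl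
    rw [h1, ← Measure.map_map measurable_snd hpairm, hlaw2, Measure.map_map measurable_snd hpm, h2,
      Measure.map_id]
  have hbad : (P.prod β) {p : X × R | π (G₀ p.1 p.2) ≠ π p.1} = 0 := by
    have hD : MeasurableSet {q : Y × X | π q.2 ≠ q.1} :=
      (measurableSet_eq_fun (hπ.comp measurable_snd) measurable_fst).compl
    have hpre : {p : X × R | π (G₀ p.1 p.2) ≠ π p.1} =
        (fun p : X × R => (π p.1, G₀ p.1 p.2)) ⁻¹' {q : Y × X | π q.2 ≠ q.1} := rfl
    rw [hpre, ← Measure.map_apply hpairm hD, hlaw2, Measure.map_apply hpm hD]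
    have : (fun x : X => (π x, x)) ⁻¹' {q : Y × X | π q.2 ≠ q.1} = ∅ := by
      ext x; simp
    rw [this, measure_empty]
  -- the repaired map: identity where the fibre is missed (a null set)
  have hfix : MeasurableSet {p : X × R | π (G₀ p.1 p.2) = π p.1} :=
    measurableSet_eq_fun (hπ.comp hG₀m) (hπ.comp measurable_fst)
  refine ⟨fun x u => if π (G₀ x u) = π x then G₀ x u else x, ?_, ?_, ?_⟩
  · exact Measurable.ite hfix hG₀m measurable_fst
  · intro x u
    dsimp only
    split_ifs with h
    · exact h
    · rfl
  · have hae : (Function.uncurry fun x u => if π (G₀ x u) = π x then G₀ x u else x) =ᵐ[P.prod β]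
        Function.uncurry G₀ := by
      filter_upwards [measure_eq_zero_iff_ae_notMem.1 hbad] with p hp
      simp only [not_not] at hp
      simp only [Function.uncurry, if_pos hp]
    rw [Measure.map_congr hae, hpush]

end Transfer

/-- THE FIBREWISE RESAMPLING LEMMA for the observables of the line (registered sub-goal): `Obs` is standard
Borel (a countable product of two-point spaces), so for any measurable statistic
`π : Obs → Obs × Set (Site 2 × Site 2)` (in the line: `(eraseMid i, stripDiagram i)`), two probability laws
on `Obs` with the same `π`-marginal are joined by a measurable `π`-preserving resampling driven by a uniform
level read from the fresh bits `β`. [folklore] -/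
theorem ps_exists_fibrewise_resampler :
    ∀ (π : Obs → Obs × Set (Site 2 × Site 2)), Measurable π →
      ∀ (P P' : MeasureTheory.Measure Obs), MeasureTheory.IsProbabilityMeasure P →
      MeasureTheory.IsProbabilityMeasure P' → P.map π = P'.map π → ∀ (U : Rnd → ℝ), Measurable U →
      (∀ c ∈ Set.Icc (0 : ℝ) 1, β {u | U u ≤ c} = ENNReal.ofReal c) →
      ∃ G : Obs → Rnd → Obs, Measurable (Function.uncurry G) ∧ (∀ x u, π (G x u) = π x) ∧
        (P.prod β).map (Function.uncurry G) = P' := by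
  intro π hπ P P' hP hP' hlaw U hU hunif
  haveI : StandardBorelSpace (Set (Site 2)) := inferInstanceAs (StandardBorelSpace (Site 2 → Prop))
  haveI : StandardBorelSpace (Set (Site 2 × Site 2)) :=
    inferInstanceAs (StandardBorelSpace (Site 2 × Site 2 → Prop))
  haveI : IsProbabilityMeasure β := by
    rw [show β = sitePercolation (Site 2 × ℕ) half from rfl]
    infer_instance
  exact ps_transfer_of_uniform hπ hlaw hU hunif

end Summit.CriticalPhenomena.CardyFormulaZ2.Theorems.IKLinearTransport.PinnedDiagramExchange
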